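import Summits.QuantumFields.YangMills.Theorems.BalabanUVNodesN12AtRecord12MassSel
import Literature.MathematicalPhysics.QuantumFieldTheory.Balaban1983to89.B15Ineq180PinAtRecord
import Literature.MathematicalPhysics.QuantumFieldTheory.Balaban1983to89.Node00.N24NodesStage12Pointed

/-!
# BalabanUVNodes ∕ N12 IN THE CLOSER'S POINTED INTERFACE AT THE STAGE-12 RECORD — the N12 row `∀ P, B15Leaf (θ.res.W P)` of dag-n24-c's
# `Node00.N24_nodes₁₂_pointed` read AT THE BUNDLE OF RECORD through the W-pin `θ.pinW (WOfRecord₁₂ θ λ)`, the [IV] layer with EVERY constructible letter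
# pinned (`(λ.pinRPrime θ).pinD189χ₀ θ σ p₁`: (1.100) data, (1.89) letters, `χ′`, `dev0` of record), and the census of the free row
# (sequel of `BalabanUVNodesN12AtRecord12MassSel`; Track A, DAG node N12 = [B15, Balaban1989LargeFieldI] CMP 122 (1989) 175; cluster K1′ `StabilityBAtRecordR12e` =
# stmt-QuantumFields-19903 (rev 15; registered stubs `stub_nodes12` ∕ `stub_betaWindow12`); seat `pub-ymgap-dag-n12-d` g4 (R134 s2), 2026-08-27; count-neutral, NOT a discharge)

HONEST FRAMING.  Count-neutral kernel BOOKKEEPING BY NAME over landed modules; nothing of Bałaban's asserted; N12 NOT discharged.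
WHY THIS FILE.  dag-n24-c's module 27 `Node00/N24NodesStage12Pointed` fixes the form a CLOSER of plan g64's registered stub `stub_nodes12 : Inhabited12 F → NodesAtSomeRecord12 F`
meets (V1 ∃-currency): it CHOOSES a guarded admissible presentation `(θ, hP)`, binds a world to it by def-T's pointed clauses (`w.up P = upOfRecord₅C (θ.toStage5₁₂) P`) and
supplies every child AT `θ`'s OWN OBJECTS — for N12 the row `h12 : ∀ P, B15Leaf (θ.res.W P)` at the presentation's RESIDUAL bundle.  This module is N12's side of that interface:
* §1 THE W-PIN TRANSPORTS (`rfl` ∕ `Iff.rfl`; g32's `pinW_admissible_iff`, `Provisos₁₂.pinW`, `datumOfRecord₁₂_pinW`, `toStage5₁₂_pinW`, `WOfRecord₁₂_pinW` and dag-n08-c's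
  `guard_pinW_iff` CITED, not restated): `θ.pinW W₀` reads `W₀` at `res.W`, keeps `res.X ∕ Y ∕ Z`, `ZtUnity`, `SlotsNondegenerate`, `SLaw₁₂ ∕ TLaw₁₂`; the pointed world's
  `rBasicStep` leaf at `θ.pinW W₀` IS `B15Leaf (W₀ P)`.
* §2 CENSUS (A2, typing strength of the ∃-currency, NOT a defect of module 27 — every row there is DISPLAYED): the pointed N12 row is FREE unless `W` is read at the bundle
  of record — a DEGENERATE bundle carries `B15Leaf` (`exists_printedCarriers15_b15Leaf`), so every presentation has a W-pin at which `h12` holds with guard, provisos,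
  admissibility, datum and the other rows UNCHANGED (`exists_pinW_b15Leaf_res_W`); print reads (0.2)–(0.6) etc. at `𝐓ρ_k` OF THE TOWER OF RECORD: `W₀ := WOfRecord₁₂ θ λ` (§4).
* §3 THE FULLY-LETTERED PINNED LAYER `λ⁴ := (λ.pinRPrime θ).pinD189χ₀ θ σ p₁` (Stage-9 generic; dag-n12-e's modules 2 ∕ 4 ∕ 7 ∕ 8: the (1.100) data of 𝐑′, the
  (1.89) letters at def-R's background of record, `χ′` = p29's `chiPrime182std` with `δ′_k` of record, `dev0 = |U₀(∂q) − 1|` with `U₀ = U_{k,Z}(V_Λ)` of record):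
  the [IV] leaf at `WOfRecord₁₀ θ λ⁴ P` on print's mass proviso (`…MassSel` §3 at the pinned situations, `rfl`; its `_of_idem` corner likewise), and — NEW at this
  layer — the (1.80) ∕ (1.89) displays are NEVER VACUOUS on a run in the window at admissible Stage-12 parameters (`not_forall_not_new189_pinAllχ₀₁₂`: dag-n12-e's
  `h180_pinD189χ₀_one_of_admissible` BY NAME, the signs `0 < A₁`, `γ < 1` read off `Stage12Params.Admissible`): this seat's g2 ∕ g3 junk-situation census
  (`…_pinAll_junkSit_…`, `χ′ :≡ ⊥`) has NO analogue at `λ⁴`.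
* §4 N12's POINTED ROW AT THE BUNDLE OF RECORD: `B15Leaf ((θ.pinW (WOfRecord₁₂ θ λ⁴)).res.W P)` from `hP.base`, `hdeg`, `hmassSel ∧ hfib`, Prop. 1, (1.80) + (1.89) at `λ⁴`.
* §5 THE POINTED INTERFACE WITH N12's ROW INSTALLED: `nodes₁₂_pointed_pinW` ∕ `nodesAtSomeRecord₁₂_of_pointed_pinW` = module 27's `N24_nodes₁₂_pointed` ∕
  `N24_nodesAtSomeRecord₁₂_of_pointed` AT `θ.pinW W₀`, rows N05–N11, N13, the Cor.-3 leaves and the guard transported from `θ` VERBATIM (kernel defeq), `h12 := ∀ P, B15Leaf (W₀ P)`,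
  conclusions over `datumOfRecord₁₂ θ hP`; and `nodesAtSomeRecord₁₂_of_pointed_pinW_WOfRecord₁₂_of_massSel` — the body of `NodesAtSomeRecord12` with N12 REMOVED from «which child
  blocks» in exchange for N12's displays at `λ⁴`.
WHAT N12 THEN COSTS in the closer's form (typing strength, NOT a second gap): `hdeg` ∕ `hmassSel ∧ hfib` (NODE 00: K0b's `Record12PresentSlots` gives LIVE pre-𝐑 slots up to
the torus; positive MASS of the occurring denominators is not yet a theorem), Prop. 1 at `λ.LF P` (dag-n12-c, modulo NODE 00's expansion pieces), (1.80) + (1.89) at the pinned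
letters (dag-n12-e: tested at `V ≡ 1`, not proved), σ's regions ∕ cube families ∕ numbers residual.  One finite four-torus programme at fixed `ε`; nothing continuum ∕ ℝ⁴ ∕ OS ∕
mass gap ∕ Clay.  0 `sorry`, 0 `def`, standard axioms.  Filed `--supports` K1′ (stmt-QuantumFields-19903) `--as helper`.
Sources: [Balaban1989LargeFieldI] (0.2)–(0.6) p.176, Prop. 1 p.194, (1.80), (1.82), (1.89), (1.99)–(1.102); [Balaban1989LargeFieldII] Thm 1 + (0.1) pp.355–356; [Balaban1988Convergent] (3.16)–(3.22).
-/

noncomputable section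

open MeasureTheory

namespace Summit.QuantumFields.YangMills.BalabanUVNodes.N12AtRecord12Pointed
open Literature.MathematicalPhysics.QuantumFieldTheory.Balaban1983to89
open Literature.MathematicalPhysics.QuantumFieldTheory.Balaban1983to89.T4Continuum (T4Family FiniteEpsData)
open Literature.MathematicalPhysics.QuantumFieldTheory.Balaban1983to89.DagBinding (WorldP leavesP PrintedCarriersR PrintedCarriers15 B15Leaf B8LeafR B9LeafX B11Leaf Nodes)
open Literature.MathematicalPhysics.QuantumFieldTheory.Balaban1983to89.Node00
open B15Claim189Assembly (new189 chiPP dom)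
open B15DeterminingSets (MSField)
open B15 (Prop1Printed Ineq180)
open B15.BasicStep (Claim189)
open B8Eq17ClassAkV1 (plaqsOf)
open B15Claim189PinNonVacuity (deltaPrimeOfRecord)
open B15Ineq180PinAtRecord (h180_pinD189χ₀_one_of_admissible)
open Summit.QuantumFields.YangMills.BalabanUVNodes.N12AtRecord12MassSel (b15Leaf_WOfRecord₁₀_pinAll_of_deg_massSel)

variable {N : ℕ} [NeZero N] {F : T4Family}
/-! ## §1 THE W-PIN TRANSPORTS the pointed interface reads (kernel `rfl` ∕ `Iff.rfl`) -/

section PinW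
variable (θ : Stage12Params F N) (W₀ : B12.RunParams → PrintedCarriers15)

/-- The W-pinned presentation reads `W₀` at its residual [IV] bundle (`rfl`). [cite: Balaban1989LargeFieldI, (0.2) p.176 (bookkeeping)] -/
theorem pinW_res_W (P : B12.RunParams) : (θ.pinW F N W₀).res.W P = W₀ P := rfl

/-- … and keeps the other rows' residual carriers `X ∕ Y ∕ Z`; its Stage-9 part is the Stage-9 W-pin (`rfl` ×4; so `WOfRecord₁₀ (θ.pinW W₀).toStage9Params = WOfRecord₁₂ θ`,
g32's `WOfRecord₁₂_pinW`). [cite: Balaban1988Convergent, p.244; Balaban1989LargeFieldI, (0.2) p.176 (bookkeeping)] -/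
theorem pinW_res_X_Y_Z : (θ.pinW F N W₀).res.X = θ.res.X ∧ (θ.pinW F N W₀).res.Y = θ.res.Y ∧ (θ.pinW F N W₀).res.Z = θ.res.Z ∧
    (θ.pinW F N W₀).toStage9Params = θ.toStage9Params.pinW F N W₀ := ⟨rfl, rfl, rfl, rfl⟩

/-- … print's partition of unity for the residual 𝐓-weight factor is unchanged (`Iff.rfl`; with `SlotsNondegenerate` this is dag-n08-c's `guard_pinW_iff`).
[cite: Balaban1988Convergent, (3.16)–(3.20) pp.268–269 (bookkeeping)] -/
theorem pinW_ztUnity_iff : (θ.pinW F N W₀).ZtUnity F N ↔ θ.ZtUnity F N := Iff.rfl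

/-- … non-degeneracy of the present slots is unchanged (`Iff.rfl`). [cite: Balaban1988Convergent, (3.22) p.269 (bookkeeping)] -/
theorem pinW_slotsNondegenerate_iff : (θ.pinW F N W₀).SlotsNondegenerate ↔ θ.SlotsNondegenerate := Iff.rfl

/-- … the repaired §2 law of `ρ_j` of record is unchanged (`Iff.rfl`) … [cite: Balaban1988Convergent, (2.18) p.257, Thm 1 p.262 (bookkeeping)] -/
theorem sLaw₁₂_pinW_iff (p : B12.RunParams) (j : ℕ) : SLaw₁₂ F N (θ.pinW F N W₀) p j ↔ SLaw₁₂ F N θ p j := Iff.rfl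

/-- … and so is the 𝐓-image law (`Iff.rfl`). [cite: Balaban1988Convergent, remark p.262, (3.25) p.270 (bookkeeping)] -/
theorem tLaw₁₂_pinW_iff (p : B12.RunParams) (k : ℕ) : TLaw₁₂ F N (θ.pinW F N W₀) p k ↔ TLaw₁₂ F N θ p k := Iff.rfl

/-- **THE POINTED WORLD'S `rBasicStep` LEAF AT THE W-PINNED PRESENTATION IS `B15Leaf (W₀ P)`** (`Iff.rfl`: def-T's `toStage5₁₂_pinW` and `B15LeafKnitRecord7.rBasicStep_upOfRecord₅C_iff`).
[cite: Balaban1989LargeFieldI, Prop. 1 p.194, (0.2)–(0.6) p.176 (the leaf bound at the record; bookkeeping)] -/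
theorem rBasicStep_upOfRecord₅C_pinW_iff (P : B12.RunParams) : (upOfRecord₅C F N ((θ.pinW F N W₀).toStage5₁₂ F N) P).rBasicStep ↔ B15Leaf (W₀ P) := Iff.rfl

/-- So at a world bound to the W-pinned presentation N12 reads `W₀`: `Dag.B15_main (leavesP w P)` iff the in-edge leaves imply `B15Leaf (W₀ P)`.
[cite: Balaban1989LargeFieldI, Prop. 1 p.194, (0.2)–(0.6) p.176 (bookkeeping)] -/
theorem b15_main_iff_of_up_pinW {w : WorldP} {P : B12.RunParams} (hup : w.up P = upOfRecord₅C F N ((θ.pinW F N W₀).toStage5₁₂ F N) P) :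
    Dag.B15_main (leavesP w P) ↔ ((leavesP w P).b5 → (leavesP w P).b7 → (leavesP w P).b8 → (leavesP w P).b10 → (leavesP w P).b11 → B15Leaf (W₀ P)) := by
  show ((leavesP w P).b5 → (leavesP w P).b7 → (leavesP w P).b8 → (leavesP w P).b10 → (leavesP w P).b11 → (w.up P).rBasicStep) ↔ _
  rw [hup]
  exact Iff.rfl

end PinW

/-! ## §2 CENSUS (A2) — the pointed N12 row is FREE unless `W` is read at the bundle of record -/

section Census

/-- **A DEGENERATE [IV] BUNDLE CARRIES THE LEAF**: empty region index (so (0.4) is `0 = 0` and (0.6) an empty sum), empty Proposition-1 instances, no plaquettes,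
`remaining :≡ ⊥`, `ℝ′ := id` on the densities of any lattice `P₀` over `SU(2)`.  Kernel census of the typed conjunction `DagBinding.B15Leaf` at residual letters
(the R433 species; the converse direction is g30's `not_b15Leaf_WOfRecord₁₀_swapLF`). [cite: Balaban1989LargeFieldI, (0.4)–(0.6) p.176, Prop. 1 (1.78) p.194, (1.80) p.195, (1.89) p.198, (1.102) p.201 (bookkeeping census of the typed statements)] -/
theorem exists_printedCarriers15_b15Leaf (P₀ : Params) : ∃ W : PrintedCarriers15, B15Leaf W := by
  refine ⟨{ D := ⟨PUnit, PEmpty, inferInstance, fun _ => 0, fun e => e.elim, fun e => e.elim, fun e => e.elim, fun e => e.elim⟩,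
            Zpp := PEmpty, instZ := inferInstance, ρpp := fun e => e.elim, Rsum := fun e => e.elim,
            LF := ⟨PEmpty, fun i => i.elim, fun i => i.elim, fun i => i.elim, fun i => i.elim, fun i => i.elim, fun i => i.elim, fun i => i.elim, fun i => i.elim⟩,
            Plaq := PEmpty, dev180 := fun e => e.elim, distΛ := fun e => e.elim, εk := 0, η := 0, B₃ := 0, B₅ := 0, M := 0, δ := 0, C180 := 0,
            Cfg := PUnit, remaining := fun _ => False, dropped := fun _ => True,
            P15 := P₀, j15 := 0, G15 := SU 2, instGG15 := inferInstance, instMS15 := inferInstance, instHD15 := inferInstance,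
            Rprime := id, ρk := fun _ => 0 }, ?_, ?_, ⟨1, one_pos, fun i => i.elim⟩, fun p => p.elim, fun U hU => hU.elim, rfl⟩
  · show (0 : ℝ) = 0
    rfl
  · intro V
    show (∑ Z : PEmpty, _) = ∑ z : PEmpty, _
    simp

/-- **… SO EVERY PRESENTATION HAS A W-PIN AT WHICH THE POINTED N12 ROW HOLDS** — with the guard, the provisos, admissibility, the datum and the rows `X ∕ Y ∕ Z`, `SLaw₁₂ ∕ TLaw₁₂`
untouched (§1, g32).  Hence in the ∃-currency `h12 : ∀ P, B15Leaf (θ.res.W P)` constrains nothing by itself: the row is contentful exactly when `W` is read at the bundle of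
record `WOfRecord₁₂ θ λ` (§4) — (0.2)–(0.6), Prop. 1, (1.80), (1.89), (1.102) at `𝐓ρ_k` of the tower of record.  LOCATED; count-neutral. [cite: Balaban1989LargeFieldI, (0.2)–(0.6) p.176, Prop. 1 p.194 (bookkeeping census)] -/
theorem exists_pinW_b15Leaf_res_W (θ : Stage12Params F N) :
    ∃ W₀ : B12.RunParams → PrintedCarriers15, (∀ P, B15Leaf ((θ.pinW F N W₀).res.W P)) ∧
      ((θ.pinW F N W₀).Admissible F N ↔ θ.Admissible F N) ∧ ((θ.pinW F N W₀).ZtUnity F N ∧ (θ.pinW F N W₀).SlotsNondegenerate ↔ θ.ZtUnity F N ∧ θ.SlotsNondegenerate) ∧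
      (∀ h : θ.Provisos₁₂ F N, datumOfRecord₁₂ F N (θ.pinW F N W₀) (h.pinW W₀) = datumOfRecord₁₂ F N θ h) := by
  obtain ⟨W, hW⟩ := exists_printedCarriers15_b15Leaf (F.P 0)
  exact ⟨fun _ => W, fun _ => hW, Iff.rfl, Iff.rfl, fun _ => rfl⟩

end Census

/-! ## §3 THE FULLY-LETTERED PINNED LAYER `(λ.pinRPrime θ).pinD189χ₀ θ σ p₁` (Stage-9 generic; the ₁₂ records read `θ.toStage9Params`) -/

section Layer
variable {θ : Stage9Params F N} {lam : ResidW F N} (σ : ∀ P : B12.RunParams, Sit189 F N P.K) (p₁ : ℕ)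

/-- The fully-lettered pin IS module 4's D189 pin at the χ′- and dev0-pinned situations, after the (1.100) pin (`rfl`; dag-n12-e's `pinD189χ₀`).
[cite: Balaban1989LargeFieldI, (1.89) p.198, (1.82) p.196, (1.80) p.195, (1.100) p.201 (bookkeeping)] -/
theorem pinAllχ₀_eq : (lam.pinRPrime θ).pinD189χ₀ θ σ p₁ =
    (lam.pinRPrime θ).pinD189 θ (fun P => ((σ P).pinChi182 (deltaPrimeOfRecord F N θ P p₁ (σ P).k)).pinDev0 θ.ν) := rfl

/-- The fully-lettered layer keeps the step selector and the Proposition-1 carrier (`rfl` ×2). [cite: Balaban1989LargeFieldI, (0.2) p.176, Prop. 1 p.194 (bookkeeping)] -/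
theorem pinAllχ₀_kSel_LF : ((lam.pinRPrime θ).pinD189χ₀ θ σ p₁).kSel = lam.kSel ∧ ((lam.pinRPrime θ).pinD189χ₀ θ σ p₁).LF = lam.LF := ⟨rfl, rfl⟩

/-- **THE [IV] LEAF AT `WOfRecord₁₀ θ λ⁴ P`, `λ⁴ := (λ.pinRPrime θ).pinD189χ₀ θ σ p₁`, ON PRINT'S MASS PROVISO** — `…MassSel.b15Leaf_WOfRecord₁₀_pinAll_of_deg_massSel` at the
χ′∕dev0-pinned situation family (pin equation `rfl`).  Displayed: `θ.Provisos₁₀`, the degenerate-run support provisos, `hmassSel`, `hfib`, Proposition 1 at `λ.LF P`, and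
(1.80) ∕ (1.89) at the PINNED letters `λ⁴.D189 P` — all four remaining functions, `χ′` and the deviation `|U₀(∂q) − 1|` concrete objects of record.
[cite: Balaban1989LargeFieldI, (0.2)–(0.6) p.176, p.176 ll.14–16, Prop. 1 (1.78) p.194, (1.79)–(1.80) p.195, (1.82) p.196, (1.89) p.198, (1.99)–(1.102) pp.200–201] -/
theorem b15Leaf_WOfRecord₁₀_pinAllχ₀_of_deg_massSel (hP : θ.Provisos₁₀) {P : B12.RunParams}
    (hdeg : P.K ≤ lam.kSel P →
      (repDataOfSel (repTOfRecord9 F N θ.ν θ.τ9 (EOfRecord₁₀ F N θ) (wOfRecord₉ F N θ) θ.ppSel P (gOfRecord₁₀ F N θ P) (lam.kSel P))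
        (θ.ppSel P (gOfRecord₁₀ F N θ P) (lam.kSel P + 1)) (fibOfSeq F θ.ν θ.τ9 P (gOfRecord₁₀ F N θ P) (lam.kSel P + 1))).ProvisosSupp)
    (hmassSel : ∀ s, 0 < ∫ V, rterm (repTOfRecord9 F N θ.ν θ.τ9 (EOfRecord₁₀ F N θ) (wOfRecord₉ F N θ) θ.ppSel P (gOfRecord₁₀ F N θ P) (lam.kSel P))
      (θ.ppSel P (gOfRecord₁₀ F N θ P) (lam.kSel P + 1) s) V ∂(fieldMeasure (F.P P.K) (lam.kSel P + 1) (SU N)))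
    (hfib : ∀ s, ∃ s', θ.ppSel P (gOfRecord₁₀ F N θ P) (lam.kSel P + 1) s' = θ.ppSel P (gOfRecord₁₀ F N θ P) (lam.kSel P + 1) s ∧
      0 < ∫ V, rterm (repTOfRecord9 F N θ.ν θ.τ9 (EOfRecord₁₀ F N θ) (wOfRecord₉ F N θ) θ.ppSel P (gOfRecord₁₀ F N θ P) (lam.kSel P)) s' V
        ∂(fieldMeasure (F.P P.K) (lam.kSel P + 1) (SU N)))
    (hP1 : Prop1Printed (lam.LF P))
    (h180 : ∀ U, new189 (((lam.pinRPrime θ).pinD189χ₀ θ σ p₁).D189 P) U →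
      ∀ i, (((lam.pinRPrime θ).pinD189χ₀ θ σ p₁).D189 P).h ≤ i → i ≤ (((lam.pinRPrime θ).pinD189χ₀ θ σ p₁).D189 P).k →
        ∀ q ∈ plaqsOf (dom (((lam.pinRPrime θ).pinD189χ₀ θ σ p₁).D189 P) i),
          Ineq180 ((((lam.pinRPrime θ).pinD189χ₀ θ σ p₁).D189 P).dev0 U q) ((((lam.pinRPrime θ).pinD189χ₀ θ σ p₁).D189 P).ε (((lam.pinRPrime θ).pinD189χ₀ θ σ p₁).D189 P).k)
            (((lam.pinRPrime θ).pinD189χ₀ θ σ p₁).D189 P).η (σ P).B₃ (σ P).B₅ (σ P).M (σ P).δ ((σ P).dist q) (σ P).O1)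
    (h189 : Claim189 (new189 (((lam.pinRPrime θ).pinD189χ₀ θ σ p₁).D189 P)) (chiPP (((lam.pinRPrime θ).pinD189χ₀ θ σ p₁).D189 P))) :
    B15Leaf (WOfRecord₁₀ F N θ ((lam.pinRPrime θ).pinD189χ₀ θ σ p₁) P) :=
  b15Leaf_WOfRecord₁₀_pinAll_of_deg_massSel (fun P => ((σ P).pinChi182 (deltaPrimeOfRecord F N θ P p₁ (σ P).k)).pinDev0 θ.ν) hP hdeg hmassSel hfib hP1
    (fun U hU i hi hik q hq => h180 U hU i hi hik q hq) h189

end Layer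

section NonVacuity
variable (θ : Stage12Params F N) (lam : ResidW F N) (σ : ∀ P : B12.RunParams, Sit189 F N P.K) (p₁ : ℕ)

/-- **AT ADMISSIBLE STAGE-12 PARAMETERS THE (1.80) ∕ (1.89) DISPLAYS AT `λ⁴` ARE TESTED AT THE UNIT CONFIGURATION ON EVERY RUN IN THE WINDOW**: for a run whose history lies in
`]0, θ.γ]` up to `n ≥ (σ P).k ≥ (σ P).h` and the sign input `0 ≤ O(1)B₃B₅M⁵`, the ANTECEDENT `new189 (λ⁴.D189 P) (1, 0)` holds AND the (1.80) body holds at `(1, 0)` —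
dag-n12-e's `h180_pinD189χ₀_one_of_admissible` with `0 < A₁`, `γ < 1` READ OFF `Stage12Params.Admissible` (`Pos₁₂`). [cite: Balaban1989LargeFieldI, (1.80) p.195, (1.82) p.196, (1.89) p.198; Balaban1988Convergent, (2.4) p.255, (2.12) p.256, (3.4) p.265] -/
theorem displays_pinAllχ₀_tested_at_one₁₂ (hθ : θ.Admissible F N) (P : B12.RunParams) {n : ℕ}
    (hI : Step.InInterval θ.γ n (gOfRecord₁₀ F N θ.toStage9Params P)) (hhk : (σ P).h ≤ (σ P).k) (hkn : (σ P).k ≤ n)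
    (hB : 0 ≤ (σ P).O1 * (σ P).B₃ * (σ P).B₅ * (σ P).M ^ 5) :
    new189 (((lam.pinRPrime θ.toStage9Params).pinD189χ₀ θ.toStage9Params σ p₁).D189 P)
        ((1 : MSField (F.P P.K) (SU N)), fun _ _ => (0 : EuclideanSpace ℝ (Fin (N ^ 2 - 1)))) ∧
      ∀ i, (((lam.pinRPrime θ.toStage9Params).pinD189χ₀ θ.toStage9Params σ p₁).D189 P).h ≤ i →
        i ≤ (((lam.pinRPrime θ.toStage9Params).pinD189χ₀ θ.toStage9Params σ p₁).D189 P).k →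
          ∀ q ∈ plaqsOf (dom (((lam.pinRPrime θ.toStage9Params).pinD189χ₀ θ.toStage9Params σ p₁).D189 P) i),
            Ineq180 ((((lam.pinRPrime θ.toStage9Params).pinD189χ₀ θ.toStage9Params σ p₁).D189 P).dev0
                ((1 : MSField (F.P P.K) (SU N)), fun _ _ => (0 : EuclideanSpace ℝ (Fin (N ^ 2 - 1)))) q)
              ((((lam.pinRPrime θ.toStage9Params).pinD189χ₀ θ.toStage9Params σ p₁).D189 P).ε
                (((lam.pinRPrime θ.toStage9Params).pinD189χ₀ θ.toStage9Params σ p₁).D189 P).k)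
              (((lam.pinRPrime θ.toStage9Params).pinD189χ₀ θ.toStage9Params σ p₁).D189 P).η (σ P).B₃ (σ P).B₅ (σ P).M (σ P).δ ((σ P).dist q) (σ P).O1 :=
  h180_pinD189χ₀_one_of_admissible (lam.pinRPrime θ.toStage9Params) σ p₁ hθ.1 hθ.2.2.2.2.2.2 hθ.2.2.2.1 P hI hhk hkn hB

/-- **… SO THIS SEAT'S JUNK-SITUATION CENSUS DIES AT `λ⁴`**: on a run in the window NO situation family voids the (1.80) ∕ (1.89) binders — the antecedent holds at
`(1, 0)` whatever the situation's residual numbers (contrast `…MassSel.exists_world₁₂CB10YZW_b15_main_pinAll_junkSit_of_massSel`, whose `σ` had `χ′ :≡ ⊥`; at `λ⁴` the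
letter `χ′` is print's `χ({|B′(b)| < δ′_k})` with `δ′_k = g_kA₁p₁(g_k) > 0`).  dag-n12-e's modules 5 ∕ 7 BY NAME (`epsOfRecord₁₀_pos_of_admissible`, `deltaPrimeOfRecord_pos_of_inInterval`,
`new189_D189OfRecord_one_iff`, `chiP_pinChi182_zero`). [cite: Balaban1989LargeFieldI, (1.82) p.196, (1.89) p.198, p.183; Balaban1988Convergent, (2.4) p.255, (2.12) p.256 (bookkeeping census)] -/
theorem new189_pinAllχ₀_one_zero₁₂ (hθ : θ.Admissible F N) (P : B12.RunParams) {n : ℕ}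
    (hI : Step.InInterval θ.γ n (gOfRecord₁₀ F N θ.toStage9Params P)) (hhk : (σ P).h ≤ (σ P).k) (hkn : (σ P).k ≤ n) :
    new189 (((lam.pinRPrime θ.toStage9Params).pinD189χ₀ θ.toStage9Params σ p₁).D189 P)
      ((1 : MSField (F.P P.K) (SU N)), fun _ _ => (0 : EuclideanSpace ℝ (Fin (N ^ 2 - 1)))) :=
  have hγ1 : θ.γ < 1 := hθ.2.2.2.2.2.2
  have hεk : 0 < epsOfRecord θ.ν (gOfRecord₁₀ F N θ.toStage9Params P) (σ P).k :=
    B15Claim189FlowAtRecord.epsOfRecord₁₀_pos_of_admissible hθ.1 hγ1 P hI (σ P).k hkn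
  have hεh : 0 < epsOfRecord θ.ν (gOfRecord₁₀ F N θ.toStage9Params P) (σ P).h :=
    B15Claim189FlowAtRecord.epsOfRecord₁₀_pos_of_admissible hθ.1 hγ1 P hI (σ P).h (hhk.trans hkn)
  (B15Claim189PinNonVacuity.new189_D189OfRecord_one_iff θ.toStage9Params P
      (((σ P).pinChi182 (deltaPrimeOfRecord F N θ.toStage9Params P p₁ (σ P).k)).pinDev0 θ.ν) hhk hθ.1.1.1.2.2.1 hεk hεh _).2
    (B15Claim189PinNonVacuity.chiP_pinChi182_zero (σ P) _
      (B15Claim189PinNonVacuity.deltaPrimeOfRecord_pos_of_inInterval θ.toStage9Params P p₁ hθ.2.2.2.1 hγ1 hI hkn))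

/-- … in the form the census used: `¬ ∀ U, ¬ new189 (λ⁴.D189 P) U` on every run in the window. [cite: Balaban1989LargeFieldI, (1.82) p.196, (1.89) p.198 (bookkeeping census)] -/
theorem not_forall_not_new189_pinAllχ₀₁₂ (hθ : θ.Admissible F N) (P : B12.RunParams) {n : ℕ}
    (hI : Step.InInterval θ.γ n (gOfRecord₁₀ F N θ.toStage9Params P)) (hhk : (σ P).h ≤ (σ P).k) (hkn : (σ P).k ≤ n) :
    ¬ ∀ U, ¬ new189 (((lam.pinRPrime θ.toStage9Params).pinD189χ₀ θ.toStage9Params σ p₁).D189 P) U := fun h =>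
  h _ (new189_pinAllχ₀_one_zero₁₂ θ lam σ p₁ hθ P hI hhk hkn)

end NonVacuity

/-! ## §4 N12's POINTED ROW AT THE BUNDLE OF RECORD -/

section Row
variable (θ : Stage12Params F N)

/-- The pointed N12 row at a W-pinned presentation IS the leaf of the pinned bundle (`Iff.rfl`). [cite: Balaban1989LargeFieldI, Prop. 1 p.194, (0.2)–(0.6) p.176 (bookkeeping)] -/
theorem b15Leaf_res_W_pinW_iff (W₀ : B12.RunParams → PrintedCarriers15) (P : B12.RunParams) : B15Leaf ((θ.pinW F N W₀).res.W P) ↔ B15Leaf (W₀ P) := Iff.rfl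

variable (lam : ResidW F N) (σ : ∀ P : B12.RunParams, Sit189 F N P.K) (p₁ : ℕ)

/-- **N12's ROW OF THE POINTED INTERFACE, READ AT THE BUNDLE OF RECORD WITH EVERY CONSTRUCTIBLE LETTER PINNED** — at the presentation
`θ.pinW (WOfRecord₁₂ θ λ⁴)`, `λ⁴ := (λ.pinRPrime θ₉).pinD189χ₀ θ₉ σ p₁` (`θ₉ := θ.toStage9Params`), the row `B15Leaf ((θ.pinW _).res.W P)` holds at run `P` from: the Stage-10
provisos of the Stage-9 part (`hP`, = `Provisos₁₂.base`), the degenerate-run support provisos (`hdeg`), positive mass of the occurring denominators with fibre witnesses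
(`hmassSel`, `hfib`), Proposition 1 at `λ.LF P` (`hP1`), (1.80) and (1.89) at the pinned letters (`h180`, `h189`).  NOT a discharge: every display is a hypothesis.
[cite: Balaban1989LargeFieldI, (0.2)–(0.6) p.176, p.176 ll.14–16, Prop. 1 (1.78) p.194, (1.79)–(1.80) p.195, (1.82) p.196, (1.89) p.198, (1.99)–(1.102) pp.200–201] -/
theorem b15Leaf_res_W_pinW_WOfRecord₁₂_pinAllχ₀_of_deg_massSel (hP : θ.toStage9Params.Provisos₁₀) {P : B12.RunParams}
    (hdeg : P.K ≤ lam.kSel P →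
      (repDataOfSel (repTOfRecord9 F N θ.ν θ.τ9 (EOfRecord₁₀ F N θ.toStage9Params) (wOfRecord₉ F N θ.toStage9Params) θ.ppSel P
          (gOfRecord₁₀ F N θ.toStage9Params P) (lam.kSel P))
        (θ.ppSel P (gOfRecord₁₀ F N θ.toStage9Params P) (lam.kSel P + 1)) (fibOfSeq F θ.ν θ.τ9 P (gOfRecord₁₀ F N θ.toStage9Params P) (lam.kSel P + 1))).ProvisosSupp)
    (hmassSel : ∀ s, 0 < ∫ V, rterm (repTOfRecord9 F N θ.ν θ.τ9 (EOfRecord₁₀ F N θ.toStage9Params) (wOfRecord₉ F N θ.toStage9Params) θ.ppSel P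
        (gOfRecord₁₀ F N θ.toStage9Params P) (lam.kSel P)) (θ.ppSel P (gOfRecord₁₀ F N θ.toStage9Params P) (lam.kSel P + 1) s) V
          ∂(fieldMeasure (F.P P.K) (lam.kSel P + 1) (SU N)))
    (hfib : ∀ s, ∃ s', θ.ppSel P (gOfRecord₁₀ F N θ.toStage9Params P) (lam.kSel P + 1) s' = θ.ppSel P (gOfRecord₁₀ F N θ.toStage9Params P) (lam.kSel P + 1) s ∧
      0 < ∫ V, rterm (repTOfRecord9 F N θ.ν θ.τ9 (EOfRecord₁₀ F N θ.toStage9Params) (wOfRecord₉ F N θ.toStage9Params) θ.ppSel P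
        (gOfRecord₁₀ F N θ.toStage9Params P) (lam.kSel P)) s' V ∂(fieldMeasure (F.P P.K) (lam.kSel P + 1) (SU N)))
    (hP1 : Prop1Printed (lam.LF P))
    (h180 : ∀ U, new189 (((lam.pinRPrime θ.toStage9Params).pinD189χ₀ θ.toStage9Params σ p₁).D189 P) U →
      ∀ i, (((lam.pinRPrime θ.toStage9Params).pinD189χ₀ θ.toStage9Params σ p₁).D189 P).h ≤ i →
        i ≤ (((lam.pinRPrime θ.toStage9Params).pinD189χ₀ θ.toStage9Params σ p₁).D189 P).k →
          ∀ q ∈ plaqsOf (dom (((lam.pinRPrime θ.toStage9Params).pinD189χ₀ θ.toStage9Params σ p₁).D189 P) i),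
            Ineq180 ((((lam.pinRPrime θ.toStage9Params).pinD189χ₀ θ.toStage9Params σ p₁).D189 P).dev0 U q)
              ((((lam.pinRPrime θ.toStage9Params).pinD189χ₀ θ.toStage9Params σ p₁).D189 P).ε
                (((lam.pinRPrime θ.toStage9Params).pinD189χ₀ θ.toStage9Params σ p₁).D189 P).k)
              (((lam.pinRPrime θ.toStage9Params).pinD189χ₀ θ.toStage9Params σ p₁).D189 P).η (σ P).B₃ (σ P).B₅ (σ P).M (σ P).δ ((σ P).dist q) (σ P).O1)
    (h189 : Claim189 (new189 (((lam.pinRPrime θ.toStage9Params).pinD189χ₀ θ.toStage9Params σ p₁).D189 P))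
      (chiPP (((lam.pinRPrime θ.toStage9Params).pinD189χ₀ θ.toStage9Params σ p₁).D189 P))) :
    B15Leaf ((θ.pinW F N (WOfRecord₁₂ F N θ ((lam.pinRPrime θ.toStage9Params).pinD189χ₀ θ.toStage9Params σ p₁))).res.W P) :=
  b15Leaf_WOfRecord₁₀_pinAllχ₀_of_deg_massSel σ p₁ hP hdeg hmassSel hfib hP1 h180 h189

end Row

/-! ## §5 THE POINTED INTERFACE WITH N12's ROW INSTALLED (module 27 BY NAME at `θ.pinW W₀`; every other row transported from `θ` by defeq) -/

section Interface
variable (θ : Stage12Params F N) (hP : θ.Provisos₁₂ F N)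

/-- **THE THIRTEEN NODES AT A WORLD BOUND TO THE W-PINNED PRESENTATION** — dag-n24-c's `N24_nodes₁₂_pointed` at `θ.pinW W₀`: the world is bound to `(θ.pinW W₀, hP.pinW W₀)`
(same construction `(datumOfRecord₁₂ θ hP).C`, block size and window letters), rows N05–N11 and N13 and the Cor.-3 leaves are module 27's AT `θ` VERBATIM (the pin keeps
`res.X ∕ Y ∕ Z`, `SLaw₁₂ ∕ TLaw₁₂` and the datum, §1), and the N12 row reads `W₀`: `h12 : ∀ P, B15Leaf (W₀ P)`.  Conclusion over `datumOfRecord₁₂ θ hP`.  COMPOSITE: nothing discharged;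
with §2's junk `W₀` the row is free (census), with `W₀ := WOfRecord₁₂ θ λ⁴` it is §4's. [cite: Balaban1989LargeFieldII, Thm 1 p.355, (0.1) pp.355–356; Balaban1989LargeFieldI, (0.2)–(0.6) p.176, Prop. 1 p.194 (node bookkeeping at the presentation's objects)] -/
theorem nodes₁₂_pointed_pinW (hθ : θ.Admissible F N) (W₀ : B12.RunParams → PrintedCarriers15) (w : WorldP)
    (hC : w.C = (datumOfRecord₁₂ F N θ hP).C) (hγ : 0 < w.γ ∧ w.γ ≤ θ.γ) (hL : w.L = (θ.L : ℝ))
    (hup : ∀ P, w.up P = upOfRecord₅C F N ((θ.pinW F N W₀).toStage5₁₂ F N) P)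
    (h05 : ∀ P : B12.RunParams,
      B8LeafR (θ.res.X P).d8 (θ.res.X P).L8 (θ.res.X P).C₂ (θ.res.X P).B₁' (θ.res.X P).B₀' (θ.res.X P).B₁ (θ.res.X P).B₂ (θ.res.X P).c₁
        (θ.res.X P).inp8 (θ.res.X P).B₀β (θ.res.X P).loc8 (θ.res.X P).fam8R (θ.res.X P).lan8 (θ.res.X P).cub8 (θ.res.X P).toAxial8)
    (h06 : ∀ P : B12.RunParams, B9LeafX (θ.res.Y P))
    (h07 : ∀ P : B12.RunParams, B11Leaf (θ.res.Z P))
    (h08 : ∀ P : B12.RunParams, ∃ (Xc : PrintedCarriersR) (I : Type) (C : B10Assembly.Consts) (T : I → B10.TowerRun),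
      Nonempty (∀ i, B10Assembly.LeafSystem C (T i)) ∧ θ.res.X P = Xc.withTowerRuns10 T)
    (h09 : ∀ P : B12.RunParams, B12Sec2to5.Lemma4Printed (θ.res.X P).F12 (θ.res.X P).c12)
    (h09T : ∀ P : B12.RunParams, (leavesP w P).smallCouplings → (leavesP w P).smallFieldInductive)
    (h10 : ∀ P : B12.RunParams, B9LeafX (θ.res.Y P) →
      (B10.Thm1PrintedCompact (θ.res.X P).runs10 ∧ B10.Thm2Printed (θ.res.X P).runs10) →
        B11Leaf (θ.res.Z P) → B12Sec2to5.Lemma4Printed (θ.res.X P).F12 (θ.res.X P).c12 →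
          B13.Lemma1Printed (θ.res.X P).S13 (θ.res.X P).c13 ∧ B13.Lemma2Printed (θ.res.X P).S13 (θ.res.X P).c13 ∧
            B13.Lemma3Printed (θ.res.X P).S13 (θ.res.X P).c13)
    (h11 : ∀ P : B12.RunParams, (leavesP w P).b7 → (leavesP w P).b8 → (leavesP w P).b9 → (leavesP w P).b10 → (leavesP w P).b11 →
      (leavesP w P).smallCouplings → (leavesP w P).smallFieldInductive → (leavesP w P).flowControl →
        ∀ k, k < P.K → SLaw₁₂ F N θ P k → TLaw₁₂ F N θ P k)
    (h12 : ∀ P : B12.RunParams, B15Leaf (W₀ P))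
    (hR : ∀ (P : B12.RunParams) (k : ℕ), k < P.K → TLaw₁₂ F N θ P k → SLaw₁₂ F N θ P (k + 1))
    (hcor3 : ∃ R : B14Cor3.ReprFamily (datumOfRecord₁₂ F N θ hP).C,
      B14Cor3.LeafH (datumOfRecord₁₂ F N θ hP).C R w.γ ∧ B14Cor3.LeafU1 (datumOfRecord₁₂ F N θ hP).C R w.γ ∧
        B14Cor3.LeafU2 (datumOfRecord₁₂ F N θ hP).C R w.γ w.ep ∧ B14Cor3.LeafL1 (datumOfRecord₁₂ F N θ hP).C R w.γ ∧
          B14Cor3.LeafL2 (datumOfRecord₁₂ F N θ hP).C R w.γ w.em) :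
    IsRecordOfRecord₁₂C F N (datumOfRecord₁₂ F N θ hP) w ∧ ∀ P : B12.RunParams, Nodes (leavesP w P) :=
  N24_nodes₁₂_pointed (θ.pinW F N W₀) (hP.pinW W₀) hθ w hC hγ hL hup h05 h06 h07 h08 h09 h09T h10 h11 h12 hR hcor3

/-- **THE BODY OF `NodesAtSomeRecord12` FROM THE POINTED CHILDREN WITH THE N12 ROW READING `W₀`** (general `N`; `N := 2` is plan g64's text): module 27's
`N24_nodesAtSomeRecord₁₂_of_pointed` at `θ.pinW W₀` — the rev-15 guard `hU` is DISPLAYED at `θ` and rides through the pin (`Iff.rfl`, dag-n08-c's `guard_pinW_iff`);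
witnesses `(θ.pinW W₀, hP.pinW W₀, w)`.  COMPOSITE: nothing discharged. [cite: Balaban1989LargeFieldII, Thm 1 p.355 + p.391; Balaban1988Convergent, (3.16)–(3.22) pp.268–269 (bookkeeping)] -/
theorem nodesAtSomeRecord₁₂_of_pointed_pinW (hθ : θ.Admissible F N) (hU : θ.ZtUnity F N ∧ θ.SlotsNondegenerate) (W₀ : B12.RunParams → PrintedCarriers15)
    (w : WorldP) (hC : w.C = (datumOfRecord₁₂ F N θ hP).C) (hγ : 0 < w.γ ∧ w.γ ≤ θ.γ) (hL : w.L = (θ.L : ℝ))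
    (hup : ∀ P, w.up P = upOfRecord₅C F N ((θ.pinW F N W₀).toStage5₁₂ F N) P)
    (h05 : ∀ P : B12.RunParams,
      B8LeafR (θ.res.X P).d8 (θ.res.X P).L8 (θ.res.X P).C₂ (θ.res.X P).B₁' (θ.res.X P).B₀' (θ.res.X P).B₁ (θ.res.X P).B₂ (θ.res.X P).c₁
        (θ.res.X P).inp8 (θ.res.X P).B₀β (θ.res.X P).loc8 (θ.res.X P).fam8R (θ.res.X P).lan8 (θ.res.X P).cub8 (θ.res.X P).toAxial8)
    (h06 : ∀ P : B12.RunParams, B9LeafX (θ.res.Y P))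
    (h07 : ∀ P : B12.RunParams, B11Leaf (θ.res.Z P))
    (h08 : ∀ P : B12.RunParams, ∃ (Xc : PrintedCarriersR) (I : Type) (C : B10Assembly.Consts) (T : I → B10.TowerRun),
      Nonempty (∀ i, B10Assembly.LeafSystem C (T i)) ∧ θ.res.X P = Xc.withTowerRuns10 T)
    (h09 : ∀ P : B12.RunParams, B12Sec2to5.Lemma4Printed (θ.res.X P).F12 (θ.res.X P).c12)
    (h09T : ∀ P : B12.RunParams, (leavesP w P).smallCouplings → (leavesP w P).smallFieldInductive)
    (h10 : ∀ P : B12.RunParams, B9LeafX (θ.res.Y P) →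
      (B10.Thm1PrintedCompact (θ.res.X P).runs10 ∧ B10.Thm2Printed (θ.res.X P).runs10) →
        B11Leaf (θ.res.Z P) → B12Sec2to5.Lemma4Printed (θ.res.X P).F12 (θ.res.X P).c12 →
          B13.Lemma1Printed (θ.res.X P).S13 (θ.res.X P).c13 ∧ B13.Lemma2Printed (θ.res.X P).S13 (θ.res.X P).c13 ∧
            B13.Lemma3Printed (θ.res.X P).S13 (θ.res.X P).c13)
    (h11 : ∀ P : B12.RunParams, (leavesP w P).b7 → (leavesP w P).b8 → (leavesP w P).b9 → (leavesP w P).b10 → (leavesP w P).b11 →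
      (leavesP w P).smallCouplings → (leavesP w P).smallFieldInductive → (leavesP w P).flowControl →
        ∀ k, k < P.K → SLaw₁₂ F N θ P k → TLaw₁₂ F N θ P k)
    (h12 : ∀ P : B12.RunParams, B15Leaf (W₀ P))
    (hR : ∀ (P : B12.RunParams) (k : ℕ), k < P.K → TLaw₁₂ F N θ P k → SLaw₁₂ F N θ P (k + 1))
    (hcor3 : ∃ R : B14Cor3.ReprFamily (datumOfRecord₁₂ F N θ hP).C,
      B14Cor3.LeafH (datumOfRecord₁₂ F N θ hP).C R w.γ ∧ B14Cor3.LeafU1 (datumOfRecord₁₂ F N θ hP).C R w.γ ∧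
        B14Cor3.LeafU2 (datumOfRecord₁₂ F N θ hP).C R w.γ w.ep ∧ B14Cor3.LeafL1 (datumOfRecord₁₂ F N θ hP).C R w.γ ∧
          B14Cor3.LeafL2 (datumOfRecord₁₂ F N θ hP).C R w.γ w.em) :
    ∃ (θ' : Stage12Params F N) (h' : θ'.Provisos₁₂ F N) (w' : WorldP), (θ'.ZtUnity F N ∧ θ'.SlotsNondegenerate) ∧ θ'.Admissible F N ∧
      IsRecordOfRecord₁₂C F N (datumOfRecord₁₂ F N θ' h') w' ∧ ∀ P : B12.RunParams, Nodes (leavesP w' P) :=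
  N24_nodesAtSomeRecord₁₂_of_pointed (θ.pinW F N W₀) (hP.pinW W₀) hθ hU w hC hγ hL hup h05 h06 h07 h08 h09 h09T h10 h11 h12 hR hcor3

variable (lam : ResidW F N) (σ : ∀ P : B12.RunParams, Sit189 F N P.K) (p₁ : ℕ)

/-- **THE BODY OF `NodesAtSomeRecord12` WITH N12 REMOVED FROM «WHICH CHILD BLOCKS»** — `nodesAtSomeRecord₁₂_of_pointed_pinW` at the bundle of record
`W₀ := WOfRecord₁₂ θ λ⁴`, the N12 row DISCHARGED by §4 in exchange for N12's displays at `λ⁴`, run by run: the degenerate-run support provisos, `hmassSel ∧ hfib` (NODE 00),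
Proposition 1 at `λ.LF P` (dag-n12-c's lineage), (1.80) + (1.89) at the pinned letters (dag-n12-e's lineage).  The world is the closer's, bound to `θ.pinW (WOfRecord₁₂ θ λ⁴)`;
every other row is module 27's at `θ`.  COMPOSITE; NOT a discharge of N12; count-neutral. [cite: Balaban1989LargeFieldI, (0.2)–(0.6) p.176, p.176 ll.14–16, Prop. 1 (1.78) p.194, (1.80) p.195, (1.89) p.198, (1.99)–(1.102) pp.200–201; Balaban1989LargeFieldII, Thm 1 p.355 + p.391 (bookkeeping: the stub's body)] -/
theorem nodesAtSomeRecord₁₂_of_pointed_pinW_WOfRecord₁₂_of_massSel (hθ : θ.Admissible F N) (hU : θ.ZtUnity F N ∧ θ.SlotsNondegenerate) (w : WorldP)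
    (hC : w.C = (datumOfRecord₁₂ F N θ hP).C) (hγ : 0 < w.γ ∧ w.γ ≤ θ.γ) (hL : w.L = (θ.L : ℝ))
    (hup : ∀ P, w.up P = upOfRecord₅C F N
      ((θ.pinW F N (WOfRecord₁₂ F N θ ((lam.pinRPrime θ.toStage9Params).pinD189χ₀ θ.toStage9Params σ p₁))).toStage5₁₂ F N) P)
    (h05 : ∀ P : B12.RunParams,
      B8LeafR (θ.res.X P).d8 (θ.res.X P).L8 (θ.res.X P).C₂ (θ.res.X P).B₁' (θ.res.X P).B₀' (θ.res.X P).B₁ (θ.res.X P).B₂ (θ.res.X P).c₁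
        (θ.res.X P).inp8 (θ.res.X P).B₀β (θ.res.X P).loc8 (θ.res.X P).fam8R (θ.res.X P).lan8 (θ.res.X P).cub8 (θ.res.X P).toAxial8)
    (h06 : ∀ P : B12.RunParams, B9LeafX (θ.res.Y P))
    (h07 : ∀ P : B12.RunParams, B11Leaf (θ.res.Z P))
    (h08 : ∀ P : B12.RunParams, ∃ (Xc : PrintedCarriersR) (I : Type) (C : B10Assembly.Consts) (T : I → B10.TowerRun),
      Nonempty (∀ i, B10Assembly.LeafSystem C (T i)) ∧ θ.res.X P = Xc.withTowerRuns10 T)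
    (h09 : ∀ P : B12.RunParams, B12Sec2to5.Lemma4Printed (θ.res.X P).F12 (θ.res.X P).c12)
    (h09T : ∀ P : B12.RunParams, (leavesP w P).smallCouplings → (leavesP w P).smallFieldInductive)
    (h10 : ∀ P : B12.RunParams, B9LeafX (θ.res.Y P) →
      (B10.Thm1PrintedCompact (θ.res.X P).runs10 ∧ B10.Thm2Printed (θ.res.X P).runs10) →
        B11Leaf (θ.res.Z P) → B12Sec2to5.Lemma4Printed (θ.res.X P).F12 (θ.res.X P).c12 →
          B13.Lemma1Printed (θ.res.X P).S13 (θ.res.X P).c13 ∧ B13.Lemma2Printed (θ.res.X P).S13 (θ.res.X P).c13 ∧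
            B13.Lemma3Printed (θ.res.X P).S13 (θ.res.X P).c13)
    (h11 : ∀ P : B12.RunParams, (leavesP w P).b7 → (leavesP w P).b8 → (leavesP w P).b9 → (leavesP w P).b10 → (leavesP w P).b11 →
      (leavesP w P).smallCouplings → (leavesP w P).smallFieldInductive → (leavesP w P).flowControl →
        ∀ k, k < P.K → SLaw₁₂ F N θ P k → TLaw₁₂ F N θ P k)
    (hN12 : ∀ P : B12.RunParams,
      (P.K ≤ lam.kSel P →
        (repDataOfSel (repTOfRecord9 F N θ.ν θ.τ9 (EOfRecord₁₀ F N θ.toStage9Params) (wOfRecord₉ F N θ.toStage9Params) θ.ppSel P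
            (gOfRecord₁₀ F N θ.toStage9Params P) (lam.kSel P))
          (θ.ppSel P (gOfRecord₁₀ F N θ.toStage9Params P) (lam.kSel P + 1))
          (fibOfSeq F θ.ν θ.τ9 P (gOfRecord₁₀ F N θ.toStage9Params P) (lam.kSel P + 1))).ProvisosSupp) ∧
      (∀ s, 0 < ∫ V, rterm (repTOfRecord9 F N θ.ν θ.τ9 (EOfRecord₁₀ F N θ.toStage9Params) (wOfRecord₉ F N θ.toStage9Params) θ.ppSel P
        (gOfRecord₁₀ F N θ.toStage9Params P) (lam.kSel P)) (θ.ppSel P (gOfRecord₁₀ F N θ.toStage9Params P) (lam.kSel P + 1) s) V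
          ∂(fieldMeasure (F.P P.K) (lam.kSel P + 1) (SU N))) ∧
      (∀ s, ∃ s', θ.ppSel P (gOfRecord₁₀ F N θ.toStage9Params P) (lam.kSel P + 1) s' = θ.ppSel P (gOfRecord₁₀ F N θ.toStage9Params P) (lam.kSel P + 1) s ∧
        0 < ∫ V, rterm (repTOfRecord9 F N θ.ν θ.τ9 (EOfRecord₁₀ F N θ.toStage9Params) (wOfRecord₉ F N θ.toStage9Params) θ.ppSel P
          (gOfRecord₁₀ F N θ.toStage9Params P) (lam.kSel P)) s' V ∂(fieldMeasure (F.P P.K) (lam.kSel P + 1) (SU N))) ∧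
      Prop1Printed (lam.LF P) ∧
      (∀ U, new189 (((lam.pinRPrime θ.toStage9Params).pinD189χ₀ θ.toStage9Params σ p₁).D189 P) U →
        ∀ i, (((lam.pinRPrime θ.toStage9Params).pinD189χ₀ θ.toStage9Params σ p₁).D189 P).h ≤ i →
          i ≤ (((lam.pinRPrime θ.toStage9Params).pinD189χ₀ θ.toStage9Params σ p₁).D189 P).k →
            ∀ q ∈ plaqsOf (dom (((lam.pinRPrime θ.toStage9Params).pinD189χ₀ θ.toStage9Params σ p₁).D189 P) i),
              Ineq180 ((((lam.pinRPrime θ.toStage9Params).pinD189χ₀ θ.toStage9Params σ p₁).D189 P).dev0 U q)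
                ((((lam.pinRPrime θ.toStage9Params).pinD189χ₀ θ.toStage9Params σ p₁).D189 P).ε
                  (((lam.pinRPrime θ.toStage9Params).pinD189χ₀ θ.toStage9Params σ p₁).D189 P).k)
                (((lam.pinRPrime θ.toStage9Params).pinD189χ₀ θ.toStage9Params σ p₁).D189 P).η (σ P).B₃ (σ P).B₅ (σ P).M (σ P).δ ((σ P).dist q) (σ P).O1) ∧
      Claim189 (new189 (((lam.pinRPrime θ.toStage9Params).pinD189χ₀ θ.toStage9Params σ p₁).D189 P))
        (chiPP (((lam.pinRPrime θ.toStage9Params).pinD189χ₀ θ.toStage9Params σ p₁).D189 P)))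
    (hR : ∀ (P : B12.RunParams) (k : ℕ), k < P.K → TLaw₁₂ F N θ P k → SLaw₁₂ F N θ P (k + 1))
    (hcor3 : ∃ R : B14Cor3.ReprFamily (datumOfRecord₁₂ F N θ hP).C,
      B14Cor3.LeafH (datumOfRecord₁₂ F N θ hP).C R w.γ ∧ B14Cor3.LeafU1 (datumOfRecord₁₂ F N θ hP).C R w.γ ∧
        B14Cor3.LeafU2 (datumOfRecord₁₂ F N θ hP).C R w.γ w.ep ∧ B14Cor3.LeafL1 (datumOfRecord₁₂ F N θ hP).C R w.γ ∧
          B14Cor3.LeafL2 (datumOfRecord₁₂ F N θ hP).C R w.γ w.em) :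
    ∃ (θ' : Stage12Params F N) (h' : θ'.Provisos₁₂ F N) (w' : WorldP), (θ'.ZtUnity F N ∧ θ'.SlotsNondegenerate) ∧ θ'.Admissible F N ∧
      IsRecordOfRecord₁₂C F N (datumOfRecord₁₂ F N θ' h') w' ∧ ∀ P : B12.RunParams, Nodes (leavesP w' P) :=
  nodesAtSomeRecord₁₂_of_pointed_pinW θ hP hθ hU _ w hC hγ hL hup h05 h06 h07 h08 h09 h09T h10 h11
    (fun P => by
      obtain ⟨hdeg, hmassSel, hfib, hP1, h180, h189⟩ := hN12 P
      exact b15Leaf_res_W_pinW_WOfRecord₁₂_pinAllχ₀_of_deg_massSel θ lam σ p₁ hP.base hdeg hmassSel hfib hP1 h180 h189)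
    hR hcor3

end Interface

end Summit.QuantumFields.YangMills.BalabanUVNodes.N12AtRecord12Pointed

end
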